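import Summits.CriticalPhenomena.SAWScalingLimit.Theorems.SAWDevelopingMapHexConjectureReflexWedgeGeometryB
import Summits.CriticalPhenomena.SAWScalingLimit.Theorems.SAWDevelopingMapHexConjectureReflexWedgeGeometryC

/-!
# `stub_reflexWedgeGeometry` — geometry of the truncated `300°` wedge (crux `HexConjecture`, line `marginal-reflex-wedge-cauchy-kernel`)

Registered stub `stub_reflexWedgeGeometry` of the crux skeleton for `HexConjecture`
(stmt-CriticalPhenomena-0808, Duminil-Copin–Smirnov 2012 Conjecture 1), line
`marginal-reflex-wedge-cauchy-kernel`: the GEOMETRY of the truncated reflex wedge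
`W_N = {v : ‖c_v‖ < N, arg c_v ∉ [0, π/3]}` (`IsReflexWedgeTruncation Λ N`, objects file
`SAWDevelopingMapHexConjectureMarginalWedgeDefs.lean`) rooted at the corner mid-edge `cornerEdge`, consumed
by the flux bookkeeping of the neighbouring stub `stub_reflexFluxLine`. For `N ≥ 1`:

1. `W_N` is hex-simply-connected (`reflexWedge_simplyConnected`, file `…ReflexWedgeGeometryB`);
2. the root is a boundary mid-edge (`reflexWedge_cornerDart`, file `…ReflexWedgeGeometryCoord`);
3. a `0°`-ray dart `(v, w)` is the vertical edge `((n,-1);1) → ((n,0);0)`, `n ≥ 1` (`…Coord`), so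
   `c_w - c_v = i/√3`, and EVERY self-avoiding walk of `W_N` from the root to `s(v, w)` has winding `+π`:
   the explicit bottom zigzag has winding `+π` (file `…ReflexWedgeGeometryC`) and the winding between boundary mid-edges of a
   simply connected domain is rigid (`HexMidEdgeSAW.winding_eq_of_mem_boundary`, `HexSAWPathRigidity.lean`);
4. a `60°`-ray dart is `((-1,n);1) → ((0,n);0)`, `n ≥ 0`, `c_w - c_v = e^{-iπ/6}/√3`, and every walk from the
   root to it has winding `-5π/3` (explicit walk of part D + rigidity).

No named fact is used. (The first version `…ReflexWedgeGeometryA.lean`, p90497, imported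
`HexConjecture/Negative/NonVacuity.lean`, which no longer builds after `Theses.SAWDefectDecoherence` dropped its copy of
`HexConjecture`; this series re-derives the coordinates without it and supersedes that file.)

## Part D (this file, namespace `…MarginalWedge.ReflexGeometry`): the walk around the apex to a `60°`-ray dart

For every `60°`-ray dart `((-1,n);1) → ((0,n);0)`, `n ≥ 0`, of `W_N` there is an EXPLICIT self-avoiding walk of
`W_N` from the root mid-edge to it — around the apex hexagon `cornerIn = ((0,-1);1), ((0,-1);0), ((-1,-1);1)`
and then up the column `((-1,k);0), ((-1,k);1)`, `k = 0, …, n` — whose winding is `-5π/3`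
(`reflexWedge_raySixty_walk`). As in part C the winding is `(π/3) · pturn` of the code of the walk under
the chart `hvIso.trans HV.flip` (`HexMidEdgeSAW.winding_eq_pturn_code`); the code is `wOut, hvOrigin, (0,0,t),
(1,0,f), (1,-1,t), (1,-1,f), …, (1,-n-1,t), (1,-n-1,f), (0,-n-1,t)` with turn sum `-4 + (1 - 1)·n - 1 = -5`
(`pturn_raySixty_code`). Folklore lattice bookkeeping; no named fact is used.
-/
open scoped BigOperators Classical
open Literature.Probability.LatticeModels Literature.Probability.RandomPlanarGeometry
  Literature.Probability.RandomPlanarGeometry.SAW Literature.Probability.RandomPlanarGeometry.SAW.HV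

namespace Summit.CriticalPhenomena.SAWScalingLimit.Theorems.HexConjecture.MarginalWedge.ReflexGeometry

/-! ### Turn sum of the code -/

/-- Translating a vertex of the coordinate model. [folklore] -/
theorem tr_mk₂ (c d a b : ℤ) (β : Bool) : tr (c, d) (a, b, β) = (a + c, b + d, β) := by
  simp [tr]

/-- The left turn `(1,d,t) → (1,d,f) → (1,d-1,t)`. [folklore] -/
theorem turn_col_zig (d : ℤ) : turn (1, d, true) (1, d, false) (1, d - 1, true) = 1 := by
  have h := turn_tr (1, d) (0, 0, true) (0, 0, false) (0, -1, true)
  rw [show turn ((0 : ℤ), (0 : ℤ), true) (0, 0, false) (0, -1, true) = 1 by decide] at h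
  simp only [tr_mk₂, zero_add] at h
  rw [show d - 1 = -1 + d by ring]
  exact h

/-- The right turn `(1,d,f) → (1,d-1,t) → (1,d-1,f)`. [folklore] -/
theorem turn_col_zag (d : ℤ) : turn (1, d, false) (1, d - 1, true) (1, d - 1, false) = -1 := by
  have h := turn_tr (1, d) (0, 0, false) (0, -1, true) (0, -1, false)
  rw [show turn ((0 : ℤ), (0 : ℤ), false) (0, -1, true) (0, -1, false) = -1 by decide] at h
  simp only [tr_mk₂, zero_add] at h
  rw [show d - 1 = -1 + d by ring]
  exact h

/-- The right exit turn `(1,d,t) → (1,d,f) → (0,d,t)`. [folklore] -/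
theorem turn_col_exit (d : ℤ) : turn (1, d, true) (1, d, false) (0, d, true) = -1 := by
  have h := turn_tr (1, d) (0, 0, true) (0, 0, false) (-1, 0, true)
  rw [show turn ((0 : ℤ), (0 : ℤ), true) (0, 0, false) (-1, 0, true) = -1 by decide] at h
  simpa only [tr_mk₂, zero_add, neg_add_cancel] using h

/-- The left turn at `((-1,m);1)` towards `((-1,m+1);0)`, in the code. [folklore] -/
theorem turn_col_zig' (m : ℕ) :
    turn (1, -(m : ℤ) - 1, true) (1, -(m : ℤ) - 1, false) (1, -((m + 1 : ℕ) : ℤ) - 1, true) = 1 := by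
  rw [show -((m + 1 : ℕ) : ℤ) - 1 = (-(m : ℤ) - 1) - 1 by push_cast; ring]
  exact turn_col_zig _

/-- The right turn at `((-1,m+1);0)` towards `((-1,m+1);1)`, in the code. [folklore] -/
theorem turn_col_zag' (m : ℕ) :
    turn (1, -(m : ℤ) - 1, false) (1, -((m + 1 : ℕ) : ℤ) - 1, true) (1, -((m + 1 : ℕ) : ℤ) - 1, false) = -1 := by
  rw [show -((m + 1 : ℕ) : ℤ) - 1 = (-(m : ℤ) - 1) - 1 by push_cast; ring]
  exact turn_col_zag _

/-- Appending two vertices to a path adds two turns. [folklore] -/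
theorem pturn_append_pair_pair (P : List HV) (x y z w : HV) :
    pturn (P ++ [x, y] ++ [z, w]) = pturn (P ++ [x, y]) + (turn x y z + turn y z w) := by
  rw [List.append_assoc]
  exact (pturn_append_cons_cons P [z, w] x y).trans (by simp only [pturn_cons₃, pturn_two, add_zero])

/-- Appending one vertex to a path adds one turn. [folklore] -/
theorem pturn_append_pair_single (P : List HV) (x y z : HV) :
    pturn (P ++ [x, y] ++ [z]) = pturn (P ++ [x, y]) + turn x y z := by
  rw [List.append_assoc]
  exact (pturn_append_cons_cons P [z] x y).trans (by simp only [pturn_cons₃, pturn_two, add_zero])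

/-- One period of the code. [folklore] -/
theorem colCode_range_succ (m : ℕ) :
    (List.range (m + 1)).flatMap (fun k : ℕ => [(((1 : ℤ), -(k : ℤ) - 1, true) : HV), ((1 : ℤ), -(k : ℤ) - 1, false)]) =
      (List.range m).flatMap (fun k : ℕ => [(((1 : ℤ), -(k : ℤ) - 1, true) : HV), ((1 : ℤ), -(k : ℤ) - 1, false)]) ++
        [(((1 : ℤ), -(m : ℤ) - 1, true) : HV), ((1 : ℤ), -(m : ℤ) - 1, false)] := by
  rw [List.range_succ, List.flatMap_append, List.flatMap_singleton]

/-- The turn sum of the code up to `((-1,m);1)` is `-4` (four right turns around the apex hexagon, then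
`+1, -1` per period). [folklore] -/
theorem pturn_raySixty_prefix (m : ℕ) :
    pturn ([wOut, hvOrigin, ((0 : ℤ), (0 : ℤ), true), ((1 : ℤ), (0 : ℤ), false)] ++
      (List.range (m + 1)).flatMap (fun k : ℕ => [(((1 : ℤ), -(k : ℤ) - 1, true) : HV), ((1 : ℤ), -(k : ℤ) - 1, false)])) =
      -4 := by
  induction m with
  | zero => decide
  | succ m ih =>
    rw [colCode_range_succ (m + 1), colCode_range_succ m]
    simp only [← List.append_assoc]
    rw [pturn_append_pair_pair, List.append_assoc, ← colCode_range_succ m, ih, turn_col_zig', turn_col_zag']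
    norm_num

/-- **The turn sum of the code of the walk to the `n`-th `60°`-ray dart is `-5`.** [folklore] -/
theorem pturn_raySixty_code (n : ℕ) :
    pturn (wOut :: hvOrigin :: ((0 : ℤ), (0 : ℤ), true) :: ((1 : ℤ), (0 : ℤ), false) ::
      ((List.range (n + 1)).flatMap (fun k : ℕ => [(((1 : ℤ), -(k : ℤ) - 1, true) : HV), ((1 : ℤ), -(k : ℤ) - 1, false)]) ++
        [(((0 : ℤ), -(n : ℤ) - 1, true) : HV)])) = -5 := by
  change pturn ([wOut, hvOrigin, ((0 : ℤ), (0 : ℤ), true), ((1 : ℤ), (0 : ℤ), false)] ++ (_ ++ _)) = -5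
  rw [colCode_range_succ n]
  simp only [← List.append_assoc]
  rw [pturn_append_pair_single, List.append_assoc, ← colCode_range_succ n, pturn_raySixty_prefix n, turn_col_exit]
  norm_num

/-! ### The walk around the apex and up the column `-1` -/

/-- One period of the column zigzag `((-1,k);0), ((-1,k);1)`. [folklore] -/
theorem colWalk_range_succ (m : ℕ) :
    (List.range (m + 1)).flatMap (fun k : ℕ =>
      [(((![-1, (k : ℤ)] : Site 2), (0 : Fin 2)) : HexVertex), ((![-1, (k : ℤ)] : Site 2), (1 : Fin 2))]) =
    (List.range m).flatMap (fun k : ℕ =>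
      [(((![-1, (k : ℤ)] : Site 2), (0 : Fin 2)) : HexVertex), ((![-1, (k : ℤ)] : Site 2), (1 : Fin 2))]) ++
      [(((![-1, (m : ℤ)] : Site 2), (0 : Fin 2)) : HexVertex), ((![-1, (m : ℤ)] : Site 2), (1 : Fin 2))] := by
  rw [List.range_succ, List.flatMap_append, List.flatMap_singleton]

/-- Membership in the walk. [folklore] -/
theorem mem_colWalk_iff (m : ℕ) (x : HexVertex) :
    x ∈ [cornerIn, (((![0, -1] : Site 2), (0 : Fin 2)) : HexVertex), ((![-1, -1] : Site 2), (1 : Fin 2))] ++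
      (List.range m).flatMap (fun k : ℕ =>
        [(((![-1, (k : ℤ)] : Site 2), (0 : Fin 2)) : HexVertex), ((![-1, (k : ℤ)] : Site 2), (1 : Fin 2))]) ↔
    x = cornerIn ∨ x = ((![0, -1] : Site 2), (0 : Fin 2)) ∨ x = ((![-1, -1] : Site 2), (1 : Fin 2)) ∨
      ∃ k : ℕ, k < m ∧ (x = ((![-1, (k : ℤ)] : Site 2), (0 : Fin 2)) ∨ x = ((![-1, (k : ℤ)] : Site 2), (1 : Fin 2))) := by
  simp [List.mem_flatMap, List.mem_range]

/-- The walk is a lattice path ending at `((-1,m);1)`. [folklore] -/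
theorem colWalk_chain (m : ℕ) :
    List.IsChain hexGraph.Adj ([cornerIn, (((![0, -1] : Site 2), (0 : Fin 2)) : HexVertex), ((![-1, -1] : Site 2), (1 : Fin 2))] ++
      (List.range (m + 1)).flatMap (fun k : ℕ =>
        [(((![-1, (k : ℤ)] : Site 2), (0 : Fin 2)) : HexVertex), ((![-1, (k : ℤ)] : Site 2), (1 : Fin 2))])) ∧
    ([cornerIn, (((![0, -1] : Site 2), (0 : Fin 2)) : HexVertex), ((![-1, -1] : Site 2), (1 : Fin 2))] ++
      (List.range (m + 1)).flatMap (fun k : ℕ =>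
        [(((![-1, (k : ℤ)] : Site 2), (0 : Fin 2)) : HexVertex), ((![-1, (k : ℤ)] : Site 2), (1 : Fin 2))])).getLast? =
      some (((![-1, (m : ℤ)] : Site 2), (1 : Fin 2)) : HexVertex) := by
  induction m with
  | zero =>
    have h1 : hexGraph.Adj cornerIn (((![0, -1] : Site 2), (0 : Fin 2)) : HexVertex) := by
      rw [cornerIn]; exact (hexGraph_adj_up 0 (-1)).symm
    have h2 : hexGraph.Adj (((![0, -1] : Site 2), (0 : Fin 2)) : HexVertex) ((![-1, -1] : Site 2), (1 : Fin 2)) := by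
      have h := (hexGraph_adj_e0 (-1) (-1)).symm
      norm_num at h
      exact h
    have h3 : hexGraph.Adj (((![-1, -1] : Site 2), (1 : Fin 2)) : HexVertex) ((![-1, ((0 : ℕ) : ℤ)] : Site 2), (0 : Fin 2)) := by
      have h := hexGraph_adj_e1 (-1) (-1)
      norm_num at h ⊢
      exact h
    have h4 : hexGraph.Adj (((![-1, ((0 : ℕ) : ℤ)] : Site 2), (0 : Fin 2)) : HexVertex) ((![-1, ((0 : ℕ) : ℤ)] : Site 2), (1 : Fin 2)) :=
      hexGraph_adj_up _ _
    rw [zero_add, colWalk_range_succ 0, List.range_zero, List.flatMap_nil, List.nil_append]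
    refine ⟨?_, rfl⟩
    simp only [List.cons_append, List.nil_append, List.isChain_cons_cons]
    exact ⟨h1, h2, h3, h4, List.isChain_singleton _⟩
  | succ m ih =>
    obtain ⟨hc, hl⟩ := ih
    rw [colWalk_range_succ (m + 1), ← List.append_assoc]
    refine ⟨List.IsChain.append hc (List.isChain_pair.2 (hexGraph_adj_up _ _)) ?_, ?_⟩
    · intro x hx y hy
      rw [hl] at hx
      simp only [Option.mem_def, Option.some.injEq, List.head?_cons] at hx hy
      subst hx; subst hy
      have h := hexGraph_adj_e1 (-1) (m : ℤ)
      push_cast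
      exact h
    · rw [List.getLast?_append]
      rfl

/-- The walk is self-avoiding. [folklore] -/
theorem colWalk_nodup (m : ℕ) :
    ([cornerIn, (((![0, -1] : Site 2), (0 : Fin 2)) : HexVertex), ((![-1, -1] : Site 2), (1 : Fin 2))] ++
      (List.range m).flatMap (fun k : ℕ =>
        [(((![-1, (k : ℤ)] : Site 2), (0 : Fin 2)) : HexVertex), ((![-1, (k : ℤ)] : Site 2), (1 : Fin 2))])).Nodup := by
  refine List.nodup_append.2 ⟨by simp [cornerIn], List.nodup_flatMap.2 ⟨fun k _ => by simp, ?_⟩, ?_⟩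
  · refine List.pairwise_lt_range.imp fun {k k'} hlt => ?_
    simp only [Function.onFun]
    rw [List.disjoint_left]
    intro x hx hx'
    simp only [List.mem_cons, List.not_mem_nil, or_false] at hx hx'
    rcases hx with rfl | rfl <;> rcases hx' with h | h <;> rw [mk_eq_mk_iff] at h <;> omega
  · intro x hx y hy hxy
    subst hxy
    simp only [List.mem_cons, List.not_mem_nil, or_false, cornerIn] at hx
    simp only [List.mem_flatMap, List.mem_range, List.mem_cons, List.not_mem_nil, or_false] at hy
    obtain ⟨k, -, hk⟩ := hy
    rcases hx with rfl | rfl | rfl <;> rcases hk with h | h <;> rw [mk_eq_mk_iff] at h <;> omega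

/-- The walk stays in `W_N` as soon as the outer vertex `((0,n);0)` of the dart is within radius `N`
(the three apex vertices have `9‖c‖² = 3`, and `9‖c((-1,k);0)‖² = 9k² + 3`, `9‖c((-1,k);1)‖² = 9k² + 9k + 3 ≤
9‖c((0,n);0)‖²` for `k ≤ n`). [folklore] -/
theorem colWalk_subset {Λ : Finset HexVertex} {N : ℝ} (hN : 1 ≤ N) (hW : IsReflexWedgeTruncation Λ N) (n : ℕ)
    (hw : ‖hexCenter (((![0, (n : ℤ)] : Site 2), (0 : Fin 2)) : HexVertex)‖ < N) :
    ∀ x ∈ [cornerIn, (((![0, -1] : Site 2), (0 : Fin 2)) : HexVertex), ((![-1, -1] : Site 2), (1 : Fin 2))] ++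
      (List.range (n + 1)).flatMap (fun k : ℕ =>
        [(((![-1, (k : ℤ)] : Site 2), (0 : Fin 2)) : HexVertex), ((![-1, (k : ℤ)] : Site 2), (1 : Fin 2))]),
      x ∈ Λ := by
  intro x hx
  have hc : ‖hexCenter cornerIn‖ < N := ((mem_wedge_iff hW _).1 (FluxLine.cornerIn_mem hN hW)).1
  rcases (mem_colWalk_iff (n + 1) x).1 hx with rfl | rfl | rfl | ⟨k, hk, rfl | rfl⟩
  · exact FluxLine.cornerIn_mem hN hW
  · rw [mem_wedge_iff hW]
    refine ⟨lt_of_le_of_lt ?_ hc, by norm_num⟩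
    rw [cornerIn, norm_center_le_iff]
    norm_num
  · rw [mem_wedge_iff hW]
    refine ⟨lt_of_le_of_lt ?_ hc, by norm_num⟩
    rw [cornerIn, norm_center_le_iff]
    norm_num
  · rw [mem_wedge_iff hW]
    refine ⟨lt_of_le_of_lt ?_ hw, by norm_num⟩
    have hk' : (k : ℤ) ≤ n := by exact_mod_cast Nat.lt_succ_iff.1 hk
    rw [norm_center_le_iff]
    norm_num
    nlinarith [mul_self_le_mul_self (by positivity : (0 : ℤ) ≤ (k : ℤ)) hk']
  · rw [mem_wedge_iff hW]
    refine ⟨lt_of_le_of_lt ?_ hw, by norm_num⟩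
    have hk' : (k : ℤ) ≤ n := by exact_mod_cast Nat.lt_succ_iff.1 hk
    rw [norm_center_le_iff]
    norm_num
    nlinarith [mul_self_le_mul_self (by positivity : (0 : ℤ) ≤ (k : ℤ)) hk']

/-- The edge of the `n`-th `60°`-ray dart. [folklore] -/
theorem adj_raySixty (n : ℤ) :
    hexGraph.Adj (((![-1, n] : Site 2), (1 : Fin 2)) : HexVertex) ((![0, n] : Site 2), (0 : Fin 2)) := by
  have h := hexGraph_adj_e0 (-1) n
  norm_num at h
  exact h

/-- The code of the walk under the chart. [folklore] -/
theorem colWalk_code (n : ℕ) :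
    wOut :: (([cornerIn, (((![0, -1] : Site 2), (0 : Fin 2)) : HexVertex), ((![-1, -1] : Site 2), (1 : Fin 2))] ++
      (List.range (n + 1)).flatMap (fun k : ℕ =>
        [(((![-1, (k : ℤ)] : Site 2), (0 : Fin 2)) : HexVertex), ((![-1, (k : ℤ)] : Site 2), (1 : Fin 2))])).map
        (hvIso.trans HV.flip) ++ [(hvIso.trans HV.flip) (((![0, (n : ℤ)] : Site 2), (0 : Fin 2)) : HexVertex)]) =
    wOut :: hvOrigin :: ((0 : ℤ), (0 : ℤ), true) :: ((1 : ℤ), (0 : ℤ), false) ::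
      ((List.range (n + 1)).flatMap (fun k : ℕ => [(((1 : ℤ), -(k : ℤ) - 1, true) : HV), ((1 : ℤ), -(k : ℤ) - 1, false)]) ++
        [(((0 : ℤ), -(n : ℤ) - 1, true) : HV)]) := by
  simp only [List.map_cons, List.map_flatMap, List.map_nil, chart_cornerIn, chart_apply_zero,
    chart_apply_one, neg_neg, sub_self, neg_zero, List.cons_append, List.nil_append]

/-- **The walk around the apex and up the column `-1` is a self-avoiding walk of `W_N` from the root to the
`n`-th `60°`-ray dart, of winding `-5π/3`** (outer vertex within radius `N`). [folklore] -/
theorem reflexWedge_raySixty_walk : ∀ (Λ : Finset HexVertex) (N : ℝ), 1 ≤ N → IsReflexWedgeTruncation Λ N → ∀ n : ℕ, ‖hexCenter (((![0, (n : ℤ)] : Site 2), (0 : Fin 2)) : HexVertex)‖ < N → ∃ γ : HexMidEdgeSAW Λ cornerEdge s((((![-1, (n : ℤ)] : Site 2), (1 : Fin 2)) : HexVertex), (((![0, (n : ℤ)] : Site 2), (0 : Fin 2)) : HexVertex)), γ.winding = -(5 * Real.pi / 3) := by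
  intro Λ N hN hW n hwN
  obtain ⟨hin, hout, hadjc⟩ := reflexWedge_cornerDart Λ N hN hW
  have hbd : cornerEdge ∈ hexDomainBoundary Λ :=
    ⟨(SimpleGraph.mem_edgeSet hexGraph).2 hadjc, cornerOut, cornerIn, Sym2.eq_swap, hin, hout⟩
  obtain ⟨hchain, hlast⟩ := colWalk_chain n
  have hnd := colWalk_nodup (n + 1)
  set V : List HexVertex := [cornerIn, (((![0, -1] : Site 2), (0 : Fin 2)) : HexVertex), ((![-1, -1] : Site 2), (1 : Fin 2))] ++
      (List.range (n + 1)).flatMap (fun k : ℕ =>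
        [(((![-1, (k : ℤ)] : Site 2), (0 : Fin 2)) : HexVertex), ((![-1, (k : ℤ)] : Site 2), (1 : Fin 2))]) with hV
  have hoV : cornerOut ∉ V := by
    rw [hV, mem_colWalk_iff, cornerOut, cornerIn, mk_eq_mk_iff, mk_eq_mk_iff, mk_eq_mk_iff]
    rintro (h | h | h | ⟨k, -, h | h⟩) <;> [skip; skip; skip; rw [mk_eq_mk_iff] at h; rw [mk_eq_mk_iff] at h] <;>
      omega
  have hwV : (((![0, (n : ℤ)] : Site 2), (0 : Fin 2)) : HexVertex) ∉ V := by
    rw [hV, mem_colWalk_iff, cornerIn, mk_eq_mk_iff, mk_eq_mk_iff, mk_eq_mk_iff]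
    rintro (h | h | h | ⟨k, -, h | h⟩) <;> [skip; skip; skip; rw [mk_eq_mk_iff] at h; rw [mk_eq_mk_iff] at h] <;>
      omega
  have hne : V ≠ [] := by rw [hV]; exact List.cons_ne_nil _ _
  have hlast' : V.getLast hne = ((![-1, (n : ℤ)] : Site 2), (1 : Fin 2)) :=
    Option.some.inj ((List.getLast?_eq_some_getLast hne).symm.trans hlast)
  have hiv : cornerIn ≠ (((![-1, (n : ℤ)] : Site 2), (1 : Fin 2)) : HexVertex) := by
    rw [cornerIn, Ne, mk_eq_mk_iff]; omega
  let γ : HexMidEdgeSAW Λ cornerEdge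
      s((((![-1, (n : ℤ)] : Site 2), (1 : Fin 2)) : HexVertex), (((![0, (n : ℤ)] : Site 2), (0 : Fin 2)) : HexVertex)) :=
    { verts := V
      subset := colWalk_subset hN hW n hwN
      nodup := hnd
      isChain := hchain
      head_mem := by
        intro x hx
        rw [hV, List.cons_append, List.head?_cons, Option.some.injEq] at hx
        rw [← hx, cornerEdge]
        exact Sym2.mem_mk_left _ _
      getLast_mem := by
        intro x hx
        rw [hlast, Option.some.injEq] at hx
        rw [← hx]
        exact Sym2.mem_mk_left _ _
      eq_of_nil := fun h => absurd h hne
      edges_nodup := fun _ => by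
        rw [cornerEdge]
        have hmem : cornerIn ∈ V := by rw [hV]; exact List.mem_cons_self
        exact edges_nodup_ext hnd hoV hwV hmem (Or.inl hiv)
      fst_mem := hexDomainBoundary_subset Λ hbd }
  refine ⟨γ, ?_⟩
  have hcode := γ.winding_eq_pturn_code (u := cornerOut) (w₁ := cornerIn) (Φ := hvIso.trans HV.flip)
    (by rw [cornerEdge, Sym2.eq_swap]) hout chart_cornerOut chart_cornerIn (adj_raySixty n)
    chart_affine (by norm_num) hne (e := ((![0, (n : ℤ)] : Site 2), (0 : Fin 2))) (Or.inl ⟨hlast', rfl⟩)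
  rw [hcode, show γ.verts = V from rfl, hV, colWalk_code n, pturn_raySixty_code n]
  push_cast
  ring

end Summit.CriticalPhenomena.SAWScalingLimit.Theorems.HexConjecture.MarginalWedge.ReflexGeometry


namespace Summit.CriticalPhenomena.SAWScalingLimit.Theorems.HexConjecture.MarginalWedge

/-- **Geometry of the truncated `300°` wedge `W_N`** (registered stub `stub_reflexWedgeGeometry` of the line
`marginal-reflex-wedge-cauchy-kernel`): for `N ≥ 1`, (i) `W_N` is hex-simply-connected, (ii) the root
`cornerEdge` is a boundary mid-edge, (iii) every `0°`-ray dart is a vertical edge `c_w - c_v = i/√3` and every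
walk from the root to it has winding `+π`, (iv) every `60°`-ray dart has `c_w - c_v = e^{-iπ/6}/√3` and every
walk from the root to it has winding `-5π/3`. [folklore] -/
theorem stub_reflexWedgeGeometry : ∀ (Λ : Finset HexVertex) (N : ℝ), 1 ≤ N → IsReflexWedgeTruncation Λ N → hexDomainSimplyConnected Λ ∧ cornerEdge ∈ hexDomainBoundary Λ ∧ (∀ v w : HexVertex, v ∈ Λ → w ∉ Λ → hexGraph.Adj v w → IsRayZeroDart N v w → hexCenter w - hexCenter v = ((Real.sqrt 3)⁻¹ : ℝ) * Complex.I ∧ ∀ γ : HexMidEdgeSAW Λ cornerEdge s(v, w), γ.winding = Real.pi) ∧ (∀ v w : HexVertex, v ∈ Λ → w ∉ Λ → hexGraph.Adj v w → IsRaySixtyDart N v w → hexCenter w - hexCenter v = ((Real.sqrt 3)⁻¹ : ℝ) * Complex.exp (-(Real.pi / 6) * Complex.I) ∧ ∀ γ : HexMidEdgeSAW Λ cornerEdge s(v, w), γ.winding = -(5 * Real.pi / 3)) := by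
  intro Λ N hN hW
  have hsc := ReflexGeometry.reflexWedge_simplyConnected Λ N hN hW
  obtain ⟨hin, hout, hadjc⟩ := ReflexGeometry.reflexWedge_cornerDart Λ N hN hW
  have ha : cornerEdge ∈ hexDomainBoundary Λ :=
    ⟨(SimpleGraph.mem_edgeSet hexGraph).2 hadjc, cornerOut, cornerIn, Sym2.eq_swap, hin, hout⟩
  refine ⟨hsc, ha, ?_, ?_⟩
  · intro v w hv hw hadj hray
    obtain ⟨n, hn, hvw⟩ := ReflexGeometry.rayZeroDart_eq hW hw hadj hray
    obtain ⟨rfl, rfl⟩ := Prod.mk.inj hvw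
    refine ⟨ReflexGeometry.hexCenter_sub_rayZero n, fun γ => ?_⟩
    obtain ⟨γ₀, hγ₀⟩ := ReflexGeometry.reflexWedge_rayZero_walk Λ N hN hW n hn hray.1
    rw [← hγ₀]
    exact HexMidEdgeSAW.winding_eq_of_mem_boundary hsc ha
      ⟨(SimpleGraph.mem_edgeSet hexGraph).2 hadj, _, _, Sym2.eq_swap, hv, hw⟩ γ γ₀
  · intro v w hv hw hadj hray
    obtain ⟨n, hvw⟩ := ReflexGeometry.raySixtyDart_eq hW hw hadj hray
    obtain ⟨rfl, rfl⟩ := Prod.mk.inj hvw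
    refine ⟨ReflexGeometry.hexCenter_sub_raySixty n, fun γ => ?_⟩
    obtain ⟨γ₀, hγ₀⟩ := ReflexGeometry.reflexWedge_raySixty_walk Λ N hN hW n hray.1
    rw [← hγ₀]
    exact HexMidEdgeSAW.winding_eq_of_mem_boundary hsc ha
      ⟨(SimpleGraph.mem_edgeSet hexGraph).2 hadj, _, _, Sym2.eq_swap, hv, hw⟩ γ γ₀

end Summit.CriticalPhenomena.SAWScalingLimit.Theorems.HexConjecture.MarginalWedge
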